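import Summits.KontsevichZagierPeriods.KontsevichZagierPeriods.Theorems.RootDecompRelativeModAbsoluteCylLogSplitP23

/-! # `RootDecompRelativeModAbsoluteCylLogSplitP24` — part 24/25 of the mechanical ≤330-line split of `CylLogSplit.lean`
(split by the decomp-kz census seat for landing; mathematics unchanged; part 24 continues part 23). -/

noncomputable section
open Set MeasureTheory Filter Topology
open scoped BigOperators
open Literature.NumberTheory.Transcendental Literature.ModelTheory.ExponentialFields

namespace Summit.KontsevichZagierPeriods.RootDecompRelativeModAbsolute.Rung30571

namespace RegularisedLogLayer

namespace CylLog
variable {b : ℕ}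

/-- **Sign cells.**  On an open `ℚ`-sa base on which the `κᵢ` are continuous, the common refinement of the `q` sign
partitions (§3x): open `ℚ`-sa cells of full measure on each of which every `κᵢ` is `> 0`, `< 0` or `≡ 0`. -/
theorem exists_sign_cells {b q : ℕ} {G : Set (Fin b → ℝ)} (hGo : IsOpen G) (hG : IsSemialgebraic ℚ G)
    (κ : Fin q → (Fin b → ℝ) → ℝ) (hκ : ∀ i, IsSemialgebraicFunOn ℚ G (κ i))
    (hκc : ∀ i, ContinuousOn (κ i) G) :
    ∃ (N : ℕ) (D : Fin N → Set (Fin b → ℝ)) (σ : Fin N → Fin q → Fin 3),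
      (∀ e, IsSemialgebraic ℚ (D e) ∧ IsOpen (D e) ∧ D e ⊆ G) ∧ Pairwise (Function.onFun Disjoint D) ∧
      volume (G \ ⋃ e, D e) = 0 ∧
      (∀ e i, σ e i = 0 → ∀ x ∈ D e, 0 < κ i x) ∧ (∀ e i, σ e i = 1 → ∀ x ∈ D e, κ i x < 0) ∧
      (∀ e i, σ e i = 2 → ∀ x ∈ D e, κ i x = 0) := by
  choose C hC hCd hCn hC0 hC1 hC2 using fun i => exists_sign_partition hGo hG (hκ i) (hκc i)
  obtain ⟨N, D, hD, hDd, hDn, hDr⟩ :=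
    exists_common_refinement hGo hG q (fun _ => 3) C (fun i c => hC i c) (fun i => hCd i) (fun i => hCn i)
  choose σ hσ using hDr
  refine ⟨N, D, σ, hD, hDd, hDn, ?_, ?_, ?_⟩
  · intro e i h x hx
    have hx' := hσ e i hx
    rw [h] at hx'
    exact hC0 i x hx'
  · intro e i h x hx
    have hx' := hσ e i hx
    rw [h] at hx'
    exact hC1 i x hx'
  · intro e i h x hx
    have hx' := hσ e i hx
    rw [h] at hx'
    exact hC2 i x hx'

/-- **D8-top (PROVED): `CellClose ⟹ CylKernelZeroLog`.** -/
theorem cylKernelZeroLog_of_cellClose (hCC : CellClose) : CylKernelZeroLog := by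
  intro P V a₀ q c κ M hP ha₀ ha₀i hc hκ hκ1 hint hL1 hdom hV hae
  -- (1) an open full-measure sub-base on which all data are smooth
  obtain ⟨G₁, hG₁P, hG₁o, hG₁, hc_sm, hn₁⟩ := exists_open_smooth_subset hP c hc
  obtain ⟨G₂, hG₂G₁, hG₂o, hG₂, hκ_sm, hn₂⟩ :=
    exists_open_smooth_subset hG₁ κ fun i => (hκ i).mono hG₁P hG₁
  obtain ⟨G₃, hG₃G₂, hG₃o, hG₃, ha_sm, hn₃⟩ :=
    exists_open_smooth_subset hG₂ (fun _ : Fin 1 => a₀) fun _ => ha₀.mono (hG₂G₁.trans hG₁P) hG₂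
  have hG₃P : G₃ ⊆ P := hG₃G₂.trans (hG₂G₁.trans hG₁P)
  have hκc : ∀ i, ContinuousOn (κ i) G₃ := fun i => (hκ_sm i).continuousOn.mono hG₃G₂
  -- (2) sign cells
  obtain ⟨N, D, σ, hD, hDd, hDn, hσ0, hσ1, hσ2⟩ :=
    exists_sign_cells hG₃o hG₃ κ (fun i => (hκ i).mono hG₃P hG₃) hκc
  have hDP : ∀ e, D e ⊆ P := fun e => (hD e).2.2.trans hG₃P
  have hnull : volume (P \ ⋃ e, D e) = 0 := by
    have hsub : P \ ⋃ e, D e ⊆ (P \ G₁) ∪ ((G₁ \ G₂) ∪ ((G₂ \ G₃) ∪ (G₃ \ ⋃ e, D e))) := by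
      intro x hx
      by_cases h₁ : x ∈ G₁
      · by_cases h₂ : x ∈ G₂
        · by_cases h₃ : x ∈ G₃
          · exact Or.inr (Or.inr (Or.inr ⟨h₃, hx.2⟩))
          · exact Or.inr (Or.inr (Or.inl ⟨h₂, h₃⟩))
        · exact Or.inr (Or.inl ⟨h₁, h₂⟩)
      · exact Or.inl ⟨hx.1, h₁⟩
    exact measure_mono_null hsub
      (measure_union_null hn₁ (measure_union_null hn₂ (measure_union_null hn₃ hDn)))
  -- (3) restrict the cylinder to the cells
  have hcyl_sa : ∀ S : Set (Fin 1 → ℝ), IsSemialgebraic ℚ S →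
      IsSemialgebraic ℚ {z : Fin (1 + 1) → ℝ | (Fin.init z : Fin 1 → ℝ) ∈ S ∧ z (Fin.last 1) ∈ Set.Ioo 0 1} :=
    fun S hS => RTerm.isSemialgebraic_cyl hS
  obtain ⟨Vc, hVcd, hVci, hrel⟩ := exists_restrict_parts_ae (hcyl_sa P hP)
    (fun e => {z : Fin (1 + 1) → ℝ | (Fin.init z : Fin 1 → ℝ) ∈ D e ∧ z (Fin.last 1) ∈ Set.Ioo 0 1})
    (fun e => hcyl_sa _ (hD e).1) (fun e z hz => ⟨hDP e hz.1, hz.2⟩)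
    (fun e e' hne => Set.disjoint_left.mpr fun z hz hz' => Set.disjoint_left.mp (hDd hne) hz.1 hz'.1)
    (by
      refine measure_mono_null (fun z hz => ?_) (KZ.volume_setOf_init_mem_eq_zero hnull)
      refine ⟨hz.1.1, fun hU => hz.2 ?_⟩
      obtain ⟨e, he⟩ := mem_iUnion.mp hU
      exact mem_iUnion.mpr ⟨e, he, hz.1.2⟩)
    V hdom
  -- (4) each cell closes by `CellClose`
  have hVe : ∀ e, KZ.of (Vc e) ∈ KZ.relations := by
    intro e
    obtain ⟨hDsa, hDo, hDG₃⟩ := hD e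
    have hFc : ContinuousOn
        (fun x => a₀ x + ∑ i, c i x * ∫ θ in Set.Ioo (0 : ℝ) 1, θ ^ M i / (1 + θ * κ i x)) (D e) :=
      ((ha_sm 0).continuousOn.mono hDG₃).add (continuousOn_finsetSum _ fun i _ =>
        continuousOn_coeff_mul_fibreIntegral ((hc_sm i).continuousOn.mono (hDG₃.trans (hG₃G₂.trans hG₂G₁)))
          ((hκ_sm i).continuousOn.mono (hDG₃.trans hG₃G₂)) fun x hx => hκ1 i x (hDP e hx))
    have hpt := forall_eq_zero_of_ae hDo hFc (hae.mono fun x hx hxD => hx (hDP e hxD))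
    refine hCC (D e) (Vc e) a₀ q c κ M (σ e) hDo hDsa (ha₀.mono (hDP e) hDsa) ((ha_sm 0).mono hDG₃)
      (ha₀i.mono_set (hDP e)) (fun i => (hc i).mono (hDP e) hDsa)
      (fun i => (hc_sm i).mono (hDG₃.trans (hG₃G₂.trans hG₂G₁))) (fun i => (hκ i).mono (hDP e) hDsa)
      (fun i => (hκ_sm i).mono (hDG₃.trans hG₃G₂)) (fun i x hx => hκ1 i x (hDP e hx))
      (hσ0 e) (hσ1 e) (hσ2 e) (fun i => (hint i).mono_set fun z hz => ⟨hDP e hz.1, hz.2⟩)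
      (fun i => (hL1 i).mono_set (hDP e)) (hVcd e) ?_ hpt
    intro z hz
    rw [hVci e]
    have hz' : z ∈ {z : Fin (1 + 1) → ℝ | (Fin.init z : Fin 1 → ℝ) ∈ D e ∧ z (Fin.last 1) ∈ Set.Ioo 0 1} :=
      hVcd e ▸ hz
    exact hV (by rw [hdom]; exact ⟨hDP e hz'.1, hz'.2⟩)
  have e : KZ.of V = (KZ.of V - ∑ e, KZ.of (Vc e)) + ∑ e, KZ.of (Vc e) := by abel
  rw [e]
  exact add_mem hrel (sum_mem fun e _ => hVe e)

/-! ### §3ad D8-MID: `CellClose` REDUCED through `LogStructure` to the cells of EXACT INTEGER RELATIONS —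
`CellCloseLS` TYPED, `LogStructure → CellCloseLS → CellClose` PROVED (§3z `logStructure_cells` + §3v restriction). -/

/-- Auxiliary step `fin3_cases`. [bookkeeping] -/
private theorem fin3_cases (t : Fin 3) : t = 0 ∨ t = 1 ∨ t = 2 := by
  fin_cases t <;> simp

/-- The Bool pattern `κᵢ ≢ 0` of a sign pattern. -/
def sgnB {q : ℕ} (σ : Fin q → Fin 3) (i : Fin q) : Bool := !decide (σ i = 2)

/-- Auxiliary step `sgnB_true`. [bookkeeping] -/
theorem sgnB_true {q : ℕ} {σ : Fin q → Fin 3} {i : Fin q} (h : sgnB σ i = true) : σ i = 0 ∨ σ i = 1 := by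
  rcases fin3_cases (σ i) with h' | h' | h'
  · exact Or.inl h'
  · exact Or.inr h'
  · simp [sgnB, h'] at h

/-- Auxiliary step `sgnB_false`. [bookkeeping] -/
theorem sgnB_false {q : ℕ} {σ : Fin q → Fin 3} {i : Fin q} (h : sgnB σ i = false) : σ i = 2 := by
  by_contra h'
  simp [sgnB, h'] at h

open scoped ContDiff in
/-- **`CellCloseLS` — the residual AFTER the structure theorem.**  As `CellClose`, on an open `ℚ`-sa cell `E` with
smooth data and fixed signs, but the hypothesis is no longer the integral identity: it is its EXACT consequence
delivered by `LogStructure` — the polynomial parts cancel (`a₀ + Σ polyPartᵢ ≡ 0` on `E`) and the log coefficients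
`logCoefᵢ = (−1)^{Mᵢ} cᵢ/κᵢ^{Mᵢ+1}` (for `κᵢ ≢ 0`) are `Σ_r qq_r · f_r i` with `qq_r` `ℚ`-sa and EXACT integer
multiplicative relations `∏ᵢ (1+κᵢ)^{f_r i} ≡ 1` on `E`.  [this is where (R1) `r1_of_boundaryRigidity`,
`RegTorusProductBands`/§3w `regCells_mem_relations_of_zpow_rel`, the order telescope §3ab, the ℤ-lattice split and the
end-type estimates (`OneVarPowerBounds`, `OneVarLogTame`) act; UNDECIDED · ATTACKABLE-NOW] -/
def CellCloseLS : Prop :=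
  ∀ (E : Set (Fin 1 → ℝ)) (V : KZ.IntegralRep (1 + 1)) (a₀ : (Fin 1 → ℝ) → ℝ) (q : ℕ)
    (c κ : Fin q → (Fin 1 → ℝ) → ℝ) (M : Fin q → ℕ) (σ : Fin q → Fin 3)
    (R : ℕ) (f : Fin R → Fin q → ℤ) (qq : Fin R → (Fin 1 → ℝ) → ℝ),
    IsOpen E → IsSemialgebraic ℚ E →
    IsSemialgebraicFunOn ℚ E a₀ → ContDiffOn ℝ ∞ a₀ E → IntegrableOn a₀ E →
    (∀ i, IsSemialgebraicFunOn ℚ E (c i)) → (∀ i, ContDiffOn ℝ ∞ (c i) E) →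
    (∀ i, IsSemialgebraicFunOn ℚ E (κ i)) → (∀ i, ContDiffOn ℝ ∞ (κ i) E) →
    (∀ i, ∀ x ∈ E, -1 < κ i x) →
    (∀ i, σ i = 0 → ∀ x ∈ E, 0 < κ i x) → (∀ i, σ i = 1 → ∀ x ∈ E, κ i x < 0) →
    (∀ i, σ i = 2 → ∀ x ∈ E, κ i x = 0) →
    (∀ i, IntegrableOn (fun z : Fin (1 + 1) → ℝ =>
      c i (Fin.init z) * (z (Fin.last 1) ^ M i / (1 + z (Fin.last 1) * κ i (Fin.init z))))
      {z : Fin (1 + 1) → ℝ | (Fin.init z : Fin 1 → ℝ) ∈ E ∧ z (Fin.last 1) ∈ Set.Ioo 0 1}) →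
    (∀ i, IntegrableOn (fun x => c i x * ∫ θ in Set.Ioo (0 : ℝ) 1, θ ^ M i / (1 + θ * κ i x)) E) →
    V.domain = {z : Fin (1 + 1) → ℝ | (Fin.init z : Fin 1 → ℝ) ∈ E ∧ z (Fin.last 1) ∈ Set.Ioo 0 1} →
    Set.EqOn V.integrand (fun z => a₀ (Fin.init z) +
      ∑ i, c i (Fin.init z) * (z (Fin.last 1) ^ M i / (1 + z (Fin.last 1) * κ i (Fin.init z))))
      V.domain →
    (∀ x ∈ E, a₀ x + ∑ i, polyPart (sgnB σ) c κ M i x = 0) →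
    (∀ r, IsSemialgebraicFunOn ℚ E (qq r)) →
    (∀ r, ∀ x ∈ E, ∏ i, (1 + κ i x) ^ (f r i) = 1) →
    (∀ i, ∀ x ∈ E, logCoef (sgnB σ) c κ M i x = ∑ r, qq r x * (f r i : ℝ)) →
    KZ.of V ∈ KZ.relations

/-- **D8-mid (PROVED): `LogStructure ⟹ CellCloseLS ⟹ CellClose`.** -/
theorem cellClose_of_cellCloseLS (hLS : LogStructure) (h : CellCloseLS) : CellClose := by
  intro D V a₀ q c κ M σ hDo hD ha₀ ha_sm ha₀i hc hc_sm hκ hκ_sm hκ1 hσ0 hσ1 hσ2 hint hL1 hdom hV hpt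
  have hs : ∀ i, sgnB σ i = true → ∀ x ∈ D, κ i x ≠ 0 := by
    intro i hi x hx
    rcases sgnB_true hi with h0 | h1
    · exact (hσ0 i h0 x hx).ne'
    · exact (hσ1 i h1 x hx).ne
  have hs' : ∀ i, sgnB σ i = false → ∀ x ∈ D, κ i x = 0 := fun i hi x hx => hσ2 i (sgnB_false hi) x hx
  obtain ⟨N, E, hE, hEd, hEn, hcell⟩ := logStructure_cells hLS hD (sgnB σ) ha₀ hc hκ hs hs' hκ1 hpt
  have hED : ∀ e, E e ⊆ D := fun e => (hE e).2.2
  have hcyl_sa : ∀ S : Set (Fin 1 → ℝ), IsSemialgebraic ℚ S →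
      IsSemialgebraic ℚ {z : Fin (1 + 1) → ℝ | (Fin.init z : Fin 1 → ℝ) ∈ S ∧ z (Fin.last 1) ∈ Set.Ioo 0 1} :=
    fun S hS => RTerm.isSemialgebraic_cyl hS
  obtain ⟨Vc, hVcd, hVci, hrel⟩ := exists_restrict_parts_ae (hcyl_sa D hD)
    (fun e => {z : Fin (1 + 1) → ℝ | (Fin.init z : Fin 1 → ℝ) ∈ E e ∧ z (Fin.last 1) ∈ Set.Ioo 0 1})
    (fun e => hcyl_sa _ (hE e).1) (fun e z hz => ⟨hED e hz.1, hz.2⟩)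
    (fun e e' hne => Set.disjoint_left.mpr fun z hz hz' => Set.disjoint_left.mp (hEd hne) hz.1 hz'.1)
    (by
      refine measure_mono_null (fun z hz => ?_) (KZ.volume_setOf_init_mem_eq_zero hEn)
      refine ⟨hz.1.1, fun hU => hz.2 ?_⟩
      obtain ⟨e, he⟩ := mem_iUnion.mp hU
      exact mem_iUnion.mpr ⟨e, he, hz.1.2⟩)
    V hdom
  have hVe : ∀ e, KZ.of (Vc e) ∈ KZ.relations := by
    intro e
    obtain ⟨hEsa, hEo, -⟩ := hE e
    obtain ⟨hpoly, R, f, qq, hqq, hprod, hcoef⟩ := hcell e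
    refine h (E e) (Vc e) a₀ q c κ M σ R f qq hEo hEsa (ha₀.mono (hED e) hEsa) (ha_sm.mono (hED e))
      (ha₀i.mono_set (hED e)) (fun i => (hc i).mono (hED e) hEsa) (fun i => (hc_sm i).mono (hED e))
      (fun i => (hκ i).mono (hED e) hEsa) (fun i => (hκ_sm i).mono (hED e))
      (fun i x hx => hκ1 i x (hED e hx)) (fun i hi x hx => hσ0 i hi x (hED e hx))
      (fun i hi x hx => hσ1 i hi x (hED e hx)) (fun i hi x hx => hσ2 i hi x (hED e hx))
      (fun i => (hint i).mono_set fun z hz => ⟨hED e hz.1, hz.2⟩) (fun i => (hL1 i).mono_set (hED e))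
      (hVcd e) ?_ hpoly hqq hprod hcoef
    intro z hz
    rw [hVci e]
    have hz' : z ∈ {z : Fin (1 + 1) → ℝ | (Fin.init z : Fin 1 → ℝ) ∈ E e ∧ z (Fin.last 1) ∈ Set.Ioo 0 1} :=
      hVcd e ▸ hz
    exact hV (by rw [hdom]; exact ⟨hED e hz'.1, hz'.2⟩)
  have e : KZ.of V = (KZ.of V - ∑ e, KZ.of (Vc e)) + ∑ e, KZ.of (Vc e) := by abel
  rw [e]
  exact add_mem hrel (sum_mem fun e _ => hVe e)

/-- **The glue spine so far (PROVED): `LogStructure ⟹ CellCloseLS ⟹ CylKernelZeroLog`.** -/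
theorem cylKernelZeroLog_of_cellCloseLS (hLS : LogStructure) (h : CellCloseLS) : CylKernelZeroLog :=
  cylKernelZeroLog_of_cellClose (cellClose_of_cellCloseLS hLS h)

/-! ### §3ae THE ℤ-LATTICE SPLIT `L = L_Z ⊕ L′` (glue D5, pure linear algebra) — PROVED
Given the integer relation vectors `f_r ∈ ℤ^q` of a structure cell and the set `Z` of DEGENERATE indices, there are integer
vectors `gZ_k` (supported on `Z`) and `gN_k`, all in the ℤ-span of the `f_r` (so the multiplicative relations transfer:
`∏ Wᵢ^{gₖ i} = ∏_r (∏ Wᵢ^{f_r i})^{n_{kr}} = 1`), such that every `f_r` is a ℚ-combination of them (so `h = Σ_r qq_r f_r`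
re-expands along the `g`'s) and a rational matrix `E` reading the `gN`-coefficients off the `N`-coordinates
(`Σ_{i∉Z} E_{ki} gN_{k'i} = δ_{kk'}`, and `Σ_{i∉Z} E_{ki} gZ_{k'i} = 0` trivially): the coefficient of `gN_k` in `h(x)` is
`Σ_{i∉Z} E_{ki} hᵢ(x)`, a ℚ-combination of the TAME coordinates.  (`L_Z = ker(π_N|_L)`, a complement `C`
(`Submodule.exists_isCompl`), `Module.finBasis`, denominators cleared, left inverse of the injective `π_N|_C`.) -/

/-- Integer scaling inside the `ℚ`-span of integer vectors. -/
theorem exists_int_scaling {q R : ℕ} (fQ : Fin R → (Fin q → ℚ)) (f : Fin R → Fin q → ℤ)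
    (hfQ : ∀ r i, fQ r i = (f r i : ℚ)) (v : Fin q → ℚ)
    (hv : v ∈ Submodule.span ℚ (Set.range fQ)) :
    ∃ (D : ℤ) (n : Fin R → ℤ), D ≠ 0 ∧ ∀ i, (D : ℚ) * v i = ∑ r, (n r : ℚ) * (f r i : ℚ) := by
  classical
  obtain ⟨a, ha⟩ := (Submodule.mem_span_range_iff_exists_fun ℚ).mp hv
  refine ⟨∏ r, ((a r).den : ℤ), fun r => (a r).num * ∏ r' ∈ Finset.univ.erase r, ((a r').den : ℤ), ?_, ?_⟩
  · exact Finset.prod_ne_zero_iff.mpr fun r _ => by exact_mod_cast (a r).den_nz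
  · intro i
    have hai : v i = ∑ r, a r * fQ r i := by
      rw [← ha]
      simp [Finset.sum_apply, Pi.smul_apply, smul_eq_mul]
    rw [hai, Finset.mul_sum]
    refine Finset.sum_congr rfl fun r _ => ?_
    rw [hfQ]
    have h1 : (((∏ r', ((a r').den : ℤ)) : ℤ) : ℚ) =
        ((a r).den : ℚ) * ∏ r' ∈ Finset.univ.erase r, ((a r').den : ℚ) := by
      push_cast
      rw [Finset.mul_prod_erase Finset.univ (fun r' => ((a r').den : ℚ)) (Finset.mem_univ r)]
    have h2 : (a r) * (a r).den = (a r).num := Rat.mul_den_eq_num (a r)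
    rw [h1]
    push_cast
    calc ((a r).den : ℚ) * (∏ r' ∈ Finset.univ.erase r, ((a r').den : ℚ)) * (a r * (f r i : ℚ))
        = (a r * (a r).den) * (∏ r' ∈ Finset.univ.erase r, ((a r').den : ℚ)) * (f r i : ℚ) := by ring
      _ = (a r).num * (∏ r' ∈ Finset.univ.erase r, ((a r').den : ℚ)) * (f r i : ℚ) := by rw [h2]

end CylLog
end RegularisedLogLayer
end Summit.KontsevichZagierPeriods.RootDecompRelativeModAbsolute.Rung30571
end
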